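import Summits.FinalStateConjecture.FinalStateConjecture.Theorems.BartnikGapSettlingBondiBartnikRigidityRouteMarchingDefs
import Literature.Geometry.Lorentzian.KerrSchildChartCovariance
import HarnessLib

/-!
# K2b-5 `stub_marchingLemma`, brick 20: continuity of the marching chart up to the slab and the roof
# portion — line `direct-method-on-the-cone` (crux `BondiBartnikRigidity`, stmt-FinalStateConjecture-10807)

The boundary-continuity hypothesis of `K2Route.ExactChartPastSet` for the charts of the marching
(`continuousOn_union_boundary`): a chart `Ψ`, smooth on the pull-back of the open Kerr-side domain `Q`
and equal to the boundary collar chart `Ψ_E` on `pullK (F ∪ S_b)` (`F ⊆ Q` the collar set, `S_b` the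
boundary set `slab ∪ roof portion`), is continuous on `pullK (Q ∪ S_b)` as soon as `Ψ_E` is continuous on
the pull-back of a set containing `F ∪ S_b` and every boundary point has a Kerr-side neighbourhood in
which the points of `Q` belong to `F` (near the floor the marching domain IS the collar set).  Pure
topology through the rest-frame identification `x ↦ Λ⁻¹(x − c)`.

References: Dafermos–Rodnianski arXiv:0811.0354, §5.1 [DafermosRodnianski2008].  No definitions, no named facts.
-/

noncomputable section

-- D-0017: single-problem summit, `Summit.<S>.<S>.…` by design (cf. lakefile `weak.linter.dupNamespace`).
set_option linter.dupNamespace false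
set_option maxSynthPendingDepth 3

open Set Filter Function Topology TopologicalSpace
open Literature.Geometry.Lorentzian
open scoped Manifold ContDiff Topology

namespace Summit.FinalStateConjecture.FinalStateConjecture.Theorems.BondiBartnikRigidity.DirectMethod

namespace BoundaryK

variable {𝒮 : Spacetime.{0} 4} {mo : lorentzGroup × E4} {M a : ℝ} {B : ModelBackground}

/-- **Continuity of the marching chart up to the boundary set** (see the module docstring).
[cite: DafermosRodnianski2008, §5.1] -/
theorem continuousOn_union_boundary
    (hB : B = starBackground mo.1 mo.2 M a (fun x => Kerr.radius a (poincareInv mo.1 mo.2 x)))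
    {Q F Sb E' : Set (Kerr.region a M)} (hQ : IsOpen Q) (hFE : F ⊆ E') (hSbE : Sb ⊆ E')
    {Ψ ΨE : B.domain → 𝒮.carrier}
    (hs : ContMDiffOn 𝓘(ℝ, E4) (𝓡 4) ∞ Ψ (pullK mo M a B Q))
    (hcontE : ContinuousOn ΨE (pullK mo M a B E'))
    (hagree : ∀ x ∈ pullK mo M a B (F ∪ Sb), Ψ x = ΨE x)
    (hloc : ∀ y ∈ Sb, ∃ N ∈ 𝓝 y, N ∩ Q ⊆ F) :
    ContinuousOn Ψ (pullK mo M a B (Q ∪ Sb)) := by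
  -- the rest-frame map
  set P : E4 → E4 := poincareInv mo.1 mo.2 with hP
  have hdom : (B.domain : Set E4) = P ⁻¹' (Kerr.region a M : Set E4) := by rw [hB]; rfl
  have hPreg : ∀ x : B.domain, P x.1 ∈ Kerr.region a M := fun x => by
    have hx : (x.1 : E4) ∈ (B.domain : Set E4) := x.2
    rw [hdom] at hx
    exact hx
  set Pr : B.domain → Kerr.region a M := fun x => ⟨P x.1, hPreg x⟩ with hPr
  have hPrc : Continuous Pr :=
    ((KerrSchildChart.contDiff_poincareInv mo.1 mo.2 (n := ∞)).continuous.comp continuous_subtype_val).subtype_mk _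
  have hmem : ∀ (S : Set (Kerr.region a M)) (x : B.domain), x ∈ pullK mo M a B S ↔ Pr x ∈ S := fun S x =>
    ⟨fun ⟨_, h⟩ => h, fun h => ⟨hPreg x, h⟩⟩
  have hQo : IsOpen (pullK mo M a B Q) := K2Route.isOpen_pullK_of_eq hB hQ
  intro x hx
  rw [hmem] at hx
  rcases hx with hxQ | hxS
  · exact ((hs x ((hmem Q x).2 hxQ)).contMDiffAt (hQo.mem_nhds ((hmem Q x).2 hxQ))).continuousAt.continuousWithinAt
  · obtain ⟨N, hN, hNF⟩ := hloc (Pr x) hxS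
    have hN' : Pr ⁻¹' N ∈ 𝓝 x := hPrc.continuousAt.preimage_mem_nhds hN
    -- near `x`, inside the set, `Ψ = ΨE` and the set lies in `pullK E'`
    have hsub : pullK mo M a B (Q ∪ Sb) ∩ Pr ⁻¹' N ⊆ pullK mo M a B E' := by
      rintro y ⟨hy, hyN⟩
      rw [hmem] at hy ⊢
      rcases hy with hyQ | hyS
      · exact hFE (hNF ⟨hyN, hyQ⟩)
      · exact hSbE hyS
    have heq : ∀ y ∈ pullK mo M a B (Q ∪ Sb) ∩ Pr ⁻¹' N, Ψ y = ΨE y := by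
      rintro y ⟨hy, hyN⟩
      rw [hmem] at hy
      refine hagree y ((hmem _ y).2 ?_)
      rcases hy with hyQ | hyS
      · exact Or.inl (hNF ⟨hyN, hyQ⟩)
      · exact Or.inr hyS
    have hxE : x ∈ pullK mo M a B E' := (hmem E' x).2 (hSbE hxS)
    have h1 : ContinuousWithinAt ΨE (pullK mo M a B (Q ∪ Sb) ∩ Pr ⁻¹' N) x := (hcontE x hxE).mono hsub
    have h2 : ContinuousWithinAt Ψ (pullK mo M a B (Q ∪ Sb) ∩ Pr ⁻¹' N) x := by
      refine h1.congr_of_eventuallyEq ?_ (heq x ⟨(hmem _ x).2 (Or.inr hxS), mem_of_mem_nhds hN'⟩)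
      exact eventually_nhdsWithin_of_forall fun y hy => heq y hy
    exact (continuousWithinAt_inter hN').1 h2

end BoundaryK

/-- **Registered bookkeeping sub-goal `stub_pullKUnionThree` of the line** (brick of the landing of K2b-5
`stub_marchingLemma`): the pull-back of a triple union (anchor of this file, whose content is the boundary
continuity of the marching chart `BoundaryK.continuousOn_union_boundary`). [folklore] -/
theorem stub_pullKUnionThree : ∀ (mo : lorentzGroup × E4) (M a : ℝ) (B : ModelBackground)
    (Q₁ Q₂ Q₃ : Set (Kerr.region a M)),
    pullK mo M a B (Q₁ ∪ Q₂ ∪ Q₃) = pullK mo M a B Q₁ ∪ pullK mo M a B Q₂ ∪ pullK mo M a B Q₃ := by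
  intro mo M a B Q₁ Q₂ Q₃
  ext x; constructor
  · rintro ⟨h, (h₁ | h₂) | h₃⟩
    · exact Or.inl (Or.inl ⟨h, h₁⟩)
    · exact Or.inl (Or.inr ⟨h, h₂⟩)
    · exact Or.inr ⟨h, h₃⟩
  · rintro ((⟨h, h₁⟩ | ⟨h, h₂⟩) | ⟨h, h₃⟩)
    · exact ⟨h, Or.inl (Or.inl h₁)⟩
    · exact ⟨h, Or.inl (Or.inr h₂)⟩
    · exact ⟨h, Or.inr h₃⟩

end Summit.FinalStateConjecture.FinalStateConjecture.Theorems.BondiBartnikRigidity.DirectMethod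

end
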